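import Literature.NumberTheory.Automorphic.AutomorphicInductionOrbitRegular
import Literature.NumberTheory.Automorphic.HenniartAutomorphicInductionStages
import Literature.NumberTheory.Automorphic.AutomorphicInductionCuspidal
import HarnessLib

/-!
# Henniart's archimedean automorphic-induction statement by stages, the intermediate cuspidal
inductions discharged (reduction of `Henniart2012_infinityType_of_automorphicInduction` to its
prime-degree and degree-one instances modulo named facts; theorems only)

Topic `NumberTheory/Automorphic`; a proof file (theorems only: no definition, no named fact, no
instance), sequel to `HenniartAutomorphicInductionStages` and `AutomorphicInductionOrbitRegular`.

`Henniart2012_infinityType_of_automorphicInduction_of_prime` (`HenniartAutomorphicInductionStages`)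
reduces the named fact `Henniart2012_infinityType_of_automorphicInduction` (G. Henniart,
*Induction automorphe globale pour les corps de nombres*, Bull. SMF 140 (2012), Thm. 5 and
Remarque finale de §3.7, read on infinity types, for a CUSPIDAL `P` automorphically induced from a
cuspidal `π` through a cyclic `L/K`) to its prime-degree instance `hprime` and its degree-one
instance `hOne` by induction in stages (Henniart, §3.1), granted `hInf` (existence of infinity
types, Clozel 1990, §3.3) and `hCusp`: whenever a cuspidal `P` over `K` is automorphically induced
from the cuspidal `π` over `L`, for every intermediate `K ⊆ K₁ ⊆ L` some CUSPIDAL `P₁` over `K₁` is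
automorphically induced from `π`. In that induction `hCusp` is only ever used with `[L : K₁]`
PRIME, where it is Arthur–Clozel's Thm. 6.2 with Lemma 6.4 (the tree's named fact
`automorphicInduction_cyclic_cuspidal`: for `L/K₁` cyclic of prime degree and `π` cuspidal with
non-Galois-stable Satake data, a cuspidal automorphic induction exists) once one knows that the
Satake data of `π` are NOT `Gal(L/K₁)`-stable — and they are not, because a cuspidal `P` over `K`
is automorphically induced from `π`: the Galois orbit of `π` under the whole of `Gal(L/K)` is
regular (Arthur–Clozel, Cor. 6.5 / Lemma 6.4; Henniart, §2.6; the tree's theorem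
`IsAutomorphicInductionAlong.not_eventually_hasSatakeParamAt_smul_of_cuspidal` of
`AutomorphicInductionOrbitRegular`, from Jacquet–Shalika (2.2)–(2.3) and multiplicity one on
`L²_cusp`), in particular under the non-trivial subgroup `Gal(L/K₁)`.

* `restrictScalars_smul_ringOfIntegers`, `restrictScalars_smul_place` — an automorphism of `L`
  over `K₁` acts on `𝓞 L` and on the finite places of `L` as its restriction of scalars to `K`
  does (bookkeeping between the two Galois actions of the tree, `GaloisActionPlaces`).
* `IsAutomorphicInductionAlong.not_isGaloisStableSatakeAE_of_cuspidal` — **the Satake data of the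
  inducing representation of a cuspidal automorphic induction are not stable under any
  non-trivial intermediate Galois group**: for `K ⊆ K₁ ⊆ L`, `L/K` Galois, `[L : K₁] > 1`, `π`
  cuspidal over `L` and `P` CUSPIDAL over `K` automorphically induced from `π`,
  `¬ IsGaloisStableSatakeAE K₁ π` (granted Jacquet–Shalika (2.3) over `K`, (2.2)–(2.3) and
  multiplicity one over `L`, named facts at every automorphic measure).
* `Henniart2012_infinityType_of_automorphicInduction_of_prime_of_cuspidalAI` — **the named fact
  from its prime-degree instance (cuspidal data), its degree-one instance, and named facts of the
  tree**: `automorphicInduction_cyclic_cuspidal` (Arthur–Clozel Thm. 6.2 + Lemma 6.4, prime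
  degree), Jacquet–Shalika (2.2)/(2.3) (`JacquetShalika1981_partialPairL_at_one_of_ne_conj`,
  `…_pole_of_eq_conj`), `multiplicity_one_gl`, and existence of infinity types
  (`AutomorphicRepData.exists_hasInfinityType`), each passed in its declared shape. The proof is
  that of `Henniart2012_infinityType_of_automorphicInduction_of_prime` (strong induction on
  `d = [L : K]`, intermediate field with `[L : K₁] = p` prime), with `hCusp` replaced as explained.

So, on the line "reduction to prime degree", the inputs of
`Henniart2012_infinityType_of_automorphicInduction` which are not named facts of the tree are
exactly its prime-degree instance for cuspidal data (Henniart, Thm. 5 and Remarque §3.7 with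
Thm. 4 = Arthur–Clozel's strong lifting, Ch. 3 Thm. 5.1 and Ch. 1 §7, for the non-cuspidal lift
`BC(P) = τ × τ^σ × ⋯`, and Henniart 2010 at the infinite places) and its degree-one instance
(transport of structure along `L ≅ K`).

## References

* G. Henniart, *Induction automorphe globale pour les corps de nombres*, Bull. Soc. Math. France
  140 (2012) 1–17: §2.6, §3.1, Thm. 3, Thm. 5 and Remarque finale de §3.7. [Henniart2012]
* J. Arthur, L. Clozel, *Simple algebras, base change, and the advanced theory of the trace
  formula*, Ann. of Math. Stud. 120 (1989), Ch. 3: §2 (2.2)–(2.3); Thm. 6.2, Lemma 6.4, Cor. 6.5.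
  [ArthurClozelAMS120]
* H. Jacquet, J. A. Shalika, *On Euler products and the classification of automorphic forms II*,
  Amer. J. Math. 103 (1981), Prop. 3.6, Thm. 4.4. [JacquetShalikaAJM1981II]
* L. Clozel, *Motifs et formes automorphes* (1990), §3.3. [Clozel1990]
-/

noncomputable section

open scoped NumberField Polynomial Classical Pointwise
open NumberField IsDedekindDomain MeasureTheory Polynomial Filter Finset
  Literature.NumberTheory.Automorphic

namespace Literature.NumberTheory.Automorphic

open AdelicGroupData

/-! ### Two Galois actions on the places of `L` -/

section RestrictScalars

variable (K : Type) [Field K] {K₁ L : Type} [Field K₁] [Field L]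
  [Algebra K K₁] [Algebra K₁ L] [Algebra K L] [IsScalarTower K K₁ L]

/-- An automorphism of `L` over `K₁` acts on `𝓞 L` as its restriction of scalars to `K ⊆ K₁` does
(both by applying the underlying ring automorphism). [folklore] -/
theorem restrictScalars_smul_ringOfIntegers (g₁ : L ≃ₐ[K₁] L) (y : 𝓞 L) :
    (AlgEquiv.restrictScalars K g₁) • y = g₁ • y := by
  apply RingOfIntegers.ext
  rfl

/-- An automorphism of `L` over `K₁` acts on the finite places of `L` as its restriction of scalars
to `K ⊆ K₁` does. [folklore] -/
theorem restrictScalars_smul_place (g₁ : L ≃ₐ[K₁] L) (w : HeightOneSpectrum (𝓞 L)) :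
    (AlgEquiv.restrictScalars K g₁) • w = g₁ • w := by
  apply HeightOneSpectrum.ext
  simp only [HeightOneSpectrum.smul_asIdeal]
  rw [Ideal.pointwise_smul_def, Ideal.pointwise_smul_def]
  congr 1

/-- Restriction of scalars takes `1` to `1`. [folklore] -/
theorem restrictScalars_one_algEquiv :
    AlgEquiv.restrictScalars K (1 : L ≃ₐ[K₁] L) = (1 : L ≃ₐ[K] L) :=
  AlgEquiv.ext fun _ => rfl

end RestrictScalars

/-! ### The inducing representation of a cuspidal automorphic induction is not stable under any
non-trivial intermediate Galois group -/

section NotStable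

variable {K K₁ L : Type} [Field K] [NumberField K] [Field K₁] [NumberField K₁] [Field L]
  [NumberField L] [Algebra K K₁] [Algebra K₁ L] [Algebra K L] [IsScalarTower K K₁ L]
  {n N : ℕ} {hK : isCompact_glFiniteIntegralLevel N K} {hL : isCompact_glFiniteIntegralLevel n L}

/-- **The Satake data of the inducing representation of a cuspidal automorphic induction are not
stable under any non-trivial intermediate Galois group** (Arthur–Clozel 1989, Ch. 3, Cor. 6.5 with
Lemma 6.4; Henniart 2012, §2.6: the automorphic induction `τ^{E/F}` of a cuspidal `τ` is cuspidal
iff the stabiliser of `τ` in the Galois group is trivial — a condition inherited by every subgroup).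
For `K ⊆ K₁ ⊆ L` with `L/K` Galois and `[L : K₁] > 1`, `π` cuspidal on `GL_n(𝔸_L)` (`n ≥ 1`) and
`P` CUSPIDAL on `GL_N(𝔸_K)` automorphically induced from `π` (Def. 6.1 a.e.), the Satake data of
`π` are not `Gal(L/K₁)`-stable (`¬ IsGaloisStableSatakeAE K₁ π`, the hypothesis of the named fact
`automorphicInduction_cyclic_cuspidal` along `L/K₁`): a non-trivial `g₁ ∈ Gal(L/K₁)` is a
non-trivial element of `Gal(L/K)`, acting on the places of `L` in the same way
(`restrictScalars_smul_place`) and preserving the place of `K₁` below, and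
`IsAutomorphicInductionAlong.not_eventually_hasSatakeParamAt_smul_of_cuspidal` (granted
Jacquet–Shalika (2.3) over `K`, (2.2)–(2.3) and multiplicity one over `L`) forbids
`t_{π, g₁ w} = t_{π, w}` for almost all `w`.
[cite: ArthurClozelAMS120, Ch. 3, Lemma 6.4 and Cor. 6.5] [cite: Henniart2012, §2.6] -/
theorem IsAutomorphicInductionAlong.not_isGaloisStableSatakeAE_of_cuspidal [IsGalois K L]
    (hn : 0 < n)
    (h23K : ∀ (μ : Measure (gl N K).automorphicQuotient) [(gl N K).IsAutomorphicMeasure μ],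
      JacquetShalika1981_partialPairL_pole_of_eq_conj (n := N) (K := K) (μ := μ))
    (h22L : ∀ (ν : Measure (gl n L).automorphicQuotient) [(gl n L).IsAutomorphicMeasure ν],
      JacquetShalika1981_partialPairL_at_one_of_ne_conj (n := n) (K := L) (μ := ν))
    (h23L : ∀ (ν : Measure (gl n L).automorphicQuotient) [(gl n L).IsAutomorphicMeasure ν],
      JacquetShalika1981_partialPairL_pole_of_eq_conj (n := n) (K := L) (μ := ν))
    (hm1L : ∀ (ν : Measure (gl n L).automorphicQuotient) [(gl n L).IsAutomorphicMeasure ν],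
      multiplicity_one_gl n L ν)
    (hK₁ : 1 < Module.finrank K₁ L)
    {π : CuspidalAutomorphicRepData n L hL} {P : CuspidalAutomorphicRepData N K hK}
    (h : IsAutomorphicInductionAlong π.1 P.1) : ¬ IsGaloisStableSatakeAE K₁ π.1 := by
  intro hst
  haveI : FiniteDimensional K₁ L := Module.Finite.of_restrictScalars_finite ℚ K₁ L
  haveI : IsGalois K₁ L := IsGalois.tower_top_of_isGalois K K₁ L
  -- a non-trivial element of `Gal(L/K₁)`, seen in `Gal(L/K)`
  have hcard : 1 < Fintype.card (L ≃ₐ[K₁] L) := by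
    rw [← Nat.card_eq_fintype_card, IsGalois.card_aut_eq_finrank]
    exact hK₁
  obtain ⟨g₁, hg₁⟩ := Fintype.exists_ne_of_one_lt_card hcard 1
  have hg : AlgEquiv.restrictScalars K g₁ ≠ (1 : L ≃ₐ[K] L) := fun h0 =>
    hg₁ (AlgEquiv.restrictScalars_injective K (h0.trans (restrictScalars_one_algEquiv K).symm))
  refine h.not_eventually_hasSatakeParamAt_smul_of_cuspidal hn h23K h22L h23L hm1L hg ?_
  filter_upwards [hst] with w hw α hα
  rw [restrictScalars_smul_place K g₁ w]
  refine hw (g₁ • w) ?_ α hα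
  have e := HeightOneSpectrum.under_algEquiv_smul K₁ L g₁ w
  rw [HeightOneSpectrum.ext_iff, HeightOneSpectrum.under_asIdeal,
    HeightOneSpectrum.under_asIdeal] at e
  exact e

end NotStable

/-! ### The named fact from its prime-degree and degree-one instances modulo named facts -/

section Reduction

/-- **Henniart's archimedean statement from its prime-degree and degree-one instances, by
induction in stages, the intermediate cuspidal inductions supplied by named facts of the tree**
(Henniart 2012, §3.1; Thm. 5 and Remarque finale de §3.7). As
`Henniart2012_infinityType_of_automorphicInduction_of_prime`, with its hypothesis `hCusp` (for every
intermediate `K ⊆ K₁ ⊆ L`, a CUSPIDAL automorphic induction of `π` over `K₁` exists as soon as a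
cuspidal one over `K` does) replaced by: `hAIc` — Arthur–Clozel's Thm. 6.2 with Lemma 6.4 in prime
degree, the named fact `automorphicInduction_cyclic_cuspidal`; and Jacquet–Shalika (2.2) at
`s = 1` for `π ≇ σ̃`, (2.3), and multiplicity one on `L²_cusp(GL)` (the named facts
`JacquetShalika1981_partialPairL_at_one_of_ne_conj`, `JacquetShalika1981_partialPairL_pole_of_eq_conj`,
`multiplicity_one_gl`, all ranks, fields and automorphic measures), through which the Satake data
of `π` are seen not to be `Gal(L/K₁)`-stable
(`IsAutomorphicInductionAlong.not_isGaloisStableSatakeAE_of_cuspidal`). The remaining hypotheses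
are those of `…_of_prime`: `hprime` (the named fact for `[L : K]` prime), `hOne` (for
`[L : K] = 1`), `hInf` (existence of infinity types of cuspidal representations, Clozel 1990 §3.3,
the named fact `AutomorphicRepData.exists_hasInfinityType`). Proof: the strong induction on
`d = [L : K] ≥ 2` of `…_of_prime` (intermediate field `K₁` with `[L : K₁] = p` prime, fixed field
of a subgroup of order `p` of the cyclic Galois group; `P` is induced from the cuspidal
`P₁ = π^{L/K₁}` along `K₁/K` by `IsAutomorphicInductionAlong.of_tower`; the identities along `K₁/K`
and `L/K₁` compose by `henniartIdentity_tower`), `P₁` being now produced by `hAIc`.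
[cite: Henniart2012, §3.1, §2.6, Thm. 3, Thm. 5 and Remarque §3.7]
[cite: ArthurClozelAMS120, Ch. 3 Thm. 6.2, Lemma 6.4, Cor. 6.5] [cite: Clozel1990, §3.3] -/
theorem Henniart2012_infinityType_of_automorphicInduction_of_prime_of_cuspidalAI
    (hprime : ∀ (K L : Type) [Field K] [NumberField K] [Field L] [NumberField L] [Algebra K L]
      [IsGalois K L], IsCyclic (L ≃ₐ[K] L) →
      ∀ (n d : ℕ), 0 < n → Module.finrank K L = d → d.Prime →
      ∀ (hK : isCompact_glFiniteIntegralLevel (d * n) K)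
        (hL : isCompact_glFiniteIntegralLevel n L)
        (P : CuspidalAutomorphicRepData (d * n) K hK) (π : CuspidalAutomorphicRepData n L hL),
        IsAutomorphicInductionAlong π.1 P.1 →
        ∀ (TP : InfinityType K (d * n)) (Tπ : InfinityType L n),
          P.1.HasInfinityType TP → π.1.HasInfinityType Tπ →
          ∀ σ : K →+* ℂ,
            (TP σ).map ArchWeight.a =
              ∑ σ' ∈ Finset.univ.filter (fun σ' : L →+* ℂ => σ'.comp (algebraMap K L) = σ),
                (Tπ σ').map ArchWeight.a)
    (hOne : ∀ (K L : Type) [Field K] [NumberField K] [Field L] [NumberField L] [Algebra K L],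
      ∀ (n : ℕ), 0 < n → Module.finrank K L = 1 →
      ∀ (hK : isCompact_glFiniteIntegralLevel (1 * n) K)
        (hL : isCompact_glFiniteIntegralLevel n L)
        (P : CuspidalAutomorphicRepData (1 * n) K hK) (π : CuspidalAutomorphicRepData n L hL),
        IsAutomorphicInductionAlong π.1 P.1 →
        ∀ (TP : InfinityType K (1 * n)) (Tπ : InfinityType L n),
          P.1.HasInfinityType TP → π.1.HasInfinityType Tπ →
          ∀ σ : K →+* ℂ,
            (TP σ).map ArchWeight.a =
              ∑ σ' ∈ Finset.univ.filter (fun σ' : L →+* ℂ => σ'.comp (algebraMap K L) = σ),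
                (Tπ σ').map ArchWeight.a)
    (hAIc : automorphicInduction_cyclic_cuspidal)
    (h22 : ∀ (N : ℕ) (K : Type) [Field K] [NumberField K]
      (μ : Measure (gl N K).automorphicQuotient) [(gl N K).IsAutomorphicMeasure μ],
      JacquetShalika1981_partialPairL_at_one_of_ne_conj (n := N) (K := K) (μ := μ))
    (h23 : ∀ (N : ℕ) (K : Type) [Field K] [NumberField K]
      (μ : Measure (gl N K).automorphicQuotient) [(gl N K).IsAutomorphicMeasure μ],
      JacquetShalika1981_partialPairL_pole_of_eq_conj (n := N) (K := K) (μ := μ))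
    (hm1 : ∀ (N : ℕ) (K : Type) [Field K] [NumberField K]
      (μ : Measure (gl N K).automorphicQuotient) [(gl N K).IsAutomorphicMeasure μ],
      multiplicity_one_gl N K μ)
    (hInf : ∀ (N : ℕ) (K : Type) [Field K] [NumberField K]
      (hK : isCompact_glFiniteIntegralLevel N K) (P : CuspidalAutomorphicRepData N K hK),
      P.1.exists_hasInfinityType) :
    Henniart2012_infinityType_of_automorphicInduction := by
  -- the statement for all cyclic `L/K` of a given degree `d ≥ 2` and `P` of free rank `N`
  have key : ∀ d : ℕ, 2 ≤ d → ∀ (K L : Type) [Field K] [NumberField K] [Field L]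
      [NumberField L] [Algebra K L] [IsGalois K L], IsCyclic (L ≃ₐ[K] L) →
        Module.finrank K L = d → ∀ (n N : ℕ), 0 < n →
        ∀ (hK : isCompact_glFiniteIntegralLevel N K) (hL : isCompact_glFiniteIntegralLevel n L)
          (P : CuspidalAutomorphicRepData N K hK) (π : CuspidalAutomorphicRepData n L hL),
          IsAutomorphicInductionAlong π.1 P.1 →
          ∀ (TP : InfinityType K N) (Tπ : InfinityType L n),
            P.1.HasInfinityType TP → π.1.HasInfinityType Tπ →
            ∀ σ : K →+* ℂ,
              (TP σ).map ArchWeight.a =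
                ∑ σ' ∈ Finset.univ.filter (fun σ' : L →+* ℂ => σ'.comp (algebraMap K L) = σ),
                  (Tπ σ').map ArchWeight.a := by
    intro d
    induction d using Nat.strong_induction_on with
    | _ d IH =>
    intro hd2 K L _ _ _ _ _ _ hcyc hdL n N hn hK hL P π hAI TP Tπ hTP hTπ σ
    haveI : FiniteDimensional K L := Module.Finite.of_restrictScalars_finite ℚ K L
    haveI := hcyc
    by_cases hdprime : d.Prime
    · /- prime degree: `hprime` -/
      exact henniartInstance_of_rank_free hdL
        (fun hK hL P π hAI => hprime K L hcyc n d hn hdL hdprime hK hL P π hAI)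
        hK hL P π hAI TP Tπ hTP hTπ σ
    · /- composite degree: an intermediate field `K₁` with `[L : K₁] = p` prime -/
      obtain ⟨p, hp, hpd⟩ := Nat.exists_prime_and_dvd (show d ≠ 1 by omega)
      haveI : Fact p.Prime := ⟨hp⟩
      have hcardG : Nat.card (L ≃ₐ[K] L) = d := (IsGalois.card_aut_eq_finrank K L).trans hdL
      obtain ⟨g, hg⟩ := exists_prime_orderOf_dvd_card' (G := L ≃ₐ[K] L) p (hcardG ▸ hpd)
      set H : Subgroup (L ≃ₐ[K] L) := Subgroup.zpowers g with hHdef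
      have hH : Nat.card H = p := by rw [hHdef, Nat.card_zpowers, hg]
      -- `H` is normal (the Galois group is cyclic, hence commutative)
      haveI hHn : H.Normal := by
        refine ⟨fun h hh g' => ?_⟩
        obtain ⟨x, hx⟩ := IsCyclic.exists_generator (α := L ≃ₐ[K] L)
        obtain ⟨a, rfl⟩ := hx g'
        obtain ⟨b, rfl⟩ := hx h
        rwa [← zpow_add, add_comm, zpow_add, mul_assoc, ← zpow_neg, ← zpow_add, add_neg_cancel,
          zpow_zero, mul_one]
      set K₁ : IntermediateField K L := IntermediateField.fixedField H with hK₁def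
      haveI : IsGalois K K₁ := IsGalois.of_fixedField_normal_subgroup H
      haveI : NumberField K₁ := NumberField.of_module_finite K K₁
      haveI : IsGalois K₁ L := IsGalois.tower_top_of_isGalois K K₁ L
      have hdegL : Module.finrank K₁ L = p := by
        rw [hK₁def, IntermediateField.finrank_fixedField_eq_card, hH]
      have hdegK : Module.finrank K K₁ * p = d := by
        rw [← hdegL, Module.finrank_mul_finrank, hdL]
      -- `Gal(L/K₁) ≅ H` and `Gal(K₁/K)` (a quotient of `Gal(L/K)`) are cyclic
      have hcycL : IsCyclic (L ≃ₐ[K₁] L) := by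
        haveI : IsCyclic K₁.fixingSubgroup := Subgroup.isCyclic _
        exact isCyclic_of_surjective (IntermediateField.fixingSubgroupEquiv K₁)
          (IntermediateField.fixingSubgroupEquiv K₁).surjective
      have hcycK : IsCyclic (K₁ ≃ₐ[K] K₁) :=
        isCyclic_of_surjective (AlgEquiv.restrictNormalHom (F := K) (K₁ := L) K₁)
          (AlgEquiv.restrictNormalHom_surjective L)
      -- `2 ≤ [K₁ : K] < d` and `2 ≤ p < d`
      have hd₁lt : Module.finrank K K₁ < d := by
        rw [← hdegK]
        exact lt_mul_of_one_lt_right (Nat.pos_of_ne_zero fun h0 => by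
          rw [h0, zero_mul] at hdegK; omega) hp.one_lt
      have hd₁ : 2 ≤ Module.finrank K K₁ := by
        by_contra hlt
        have h0 : Module.finrank K K₁ ≠ 0 := fun h0 => by rw [h0, zero_mul] at hdegK; omega
        have : Module.finrank K K₁ = 1 := by omega
        rw [this, one_mul] at hdegK
        exact hdprime (hdegK ▸ hp)
      have hplt : p < d := by
        rw [← hdegK]
        exact lt_mul_of_one_lt_left hp.pos (by omega)
      -- the Satake data of `π` are not `Gal(L/K₁)`-stable, `P` being cuspidal (Cor. 6.5)
      have hnst : ¬ IsGaloisStableSatakeAE K₁ π.1 :=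
        hAI.not_isGaloisStableSatakeAE_of_cuspidal hn (fun μ _ => h23 N K μ)
          (fun ν _ => h22 n L ν) (fun ν _ => h23 n L ν) (fun ν _ => hm1 n L ν)
          (by rw [hdegL]; exact hp.one_lt)
      -- a cuspidal `P₁ = π^{L/K₁}` over `K₁` (Thm. 6.2 + Lemma 6.4 in prime degree)
      obtain ⟨P₁, hAI₁⟩ := hAIc n K₁ L hcycL (hdegL ▸ hp) hn hL
        (isCompact_glFiniteIntegralLevel_holds _ _) π hnst
      -- `P` is induced from `P₁` along `K₁/K`; `P₁` has an infinity type
      have hAI' : IsAutomorphicInductionAlong P₁.1 P.1 := hAI.of_tower hAI₁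
      obtain ⟨T₁, hT₁⟩ := hInf _ K₁ _ P₁
      -- the identities along `K₁/K` and along `L/K₁` (induction hypothesis), composed
      have hdown := IH (Module.finrank K K₁) hd₁lt hd₁ K K₁ hcycK rfl
        (n * Module.finrank K₁ L) N (Nat.mul_pos hn (hdegL ▸ hp.pos)) hK
        (isCompact_glFiniteIntegralLevel_holds _ _) P P₁ hAI' TP T₁ hTP hT₁
      have hup := IH p hplt hp.two_le K₁ L hcycL hdegL n (n * Module.finrank K₁ L) hn
        (isCompact_glFiniteIntegralLevel_holds _ _) hL P₁ π hAI₁ T₁ Tπ hT₁ hTπ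
      exact henniartIdentity_tower (K₁ := K₁) hdown hup σ
  -- the named fact: degree `1` by `hOne`, degree `≥ 2` by `key`
  rw [Henniart2012_infinityType_of_automorphicInduction_iff_along]
  intro K L _ _ _ _ _ _ hcyc n d hn hd hK hL P π hAI TP Tπ hTP hTπ σ
  haveI : FiniteDimensional K L := Module.Finite.of_restrictScalars_finite ℚ K L
  rcases Nat.lt_or_ge d 2 with h1 | h2
  · obtain rfl : d = 1 := by
      have := Module.finrank_pos (R := K) (M := L); omega
    exact hOne K L n hn hd hK hL P π hAI TP Tπ hTP hTπ σ
  · exact key d h2 K L hcyc hd n (d * n) hn hK hL P π hAI TP Tπ hTP hTπ σ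

end Reduction

/-! ### Variant on archimedean (Harish-Chandra) parameters, existence input down to Schur's lemma -/

section ReductionArchParameter

/-- **Henniart's archimedean statement from its prime-degree instance for CUSPIDAL data stated on
Harish-Chandra parameters, its degree-one instance, and named facts of the tree.** As
`Henniart2012_infinityType_of_automorphicInduction_of_prime_of_cuspidalAI` (stages, tower cut at
the top, `[L : K₁]` prime, intermediate CUSPIDAL inductions by `automorphicInduction_cyclic_cuspidal`
off the Galois-stable locus, which is avoided by
`IsAutomorphicInductionAlong.not_isGaloisStableSatakeAE_of_cuspidal`), but the induction runs on
archimedean parameters (`AutomorphicRepData.HasArchParameter`), so that: `hprime` reads — for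
`L/K` cyclic of PRIME degree, `P` CUSPIDAL over `K` automatically induced (Def. 6.1 a.e.) from the
cuspidal `π` over `L`, and archimedean parameters `χ_P`, `χ_π`: `χ_P σ = ∑_{σ' ∣ σ} χ_π σ'`
(Henniart 2012, Thm. 5 and Remarque §3.7 for `τ^{E/F}` with `E/F` of prime degree — no rigidity
among non-cuspidal representations is involved); and the existence input is only `hArch`: every
CUSPIDAL automorphic representation of `GL_N(𝔸_K)` has an archimedean parameter. `hOne` is the
degree-one instance of the named fact. [cite: Henniart2012, §3.1, Thm. 5 and Remarque §3.7]
[cite: ArthurClozelAMS120, Ch. 3 Thm. 6.2, Lemma 6.4, Cor. 6.5] [cite: Clozel1990, §3.3] -/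
theorem Henniart2012_infinityType_of_automorphicInduction_of_prime_archParameter_of_cuspidalAI
    (hprime : ∀ (K L : Type) [Field K] [NumberField K] [Field L] [NumberField L] [Algebra K L]
      [IsGalois K L], IsCyclic (L ≃ₐ[K] L) → (Module.finrank K L).Prime →
      ∀ (n N : ℕ), 0 < n →
      ∀ (hK : isCompact_glFiniteIntegralLevel N K) (hL : isCompact_glFiniteIntegralLevel n L)
        (P : CuspidalAutomorphicRepData N K hK) (π : CuspidalAutomorphicRepData n L hL),
        IsAutomorphicInductionAlong π.1 P.1 →
        ∀ (χP : (K →+* ℂ) → Multiset ℂ) (χπ : (L →+* ℂ) → Multiset ℂ),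
          P.1.HasArchParameter χP → π.1.HasArchParameter χπ →
          ∀ σ : K →+* ℂ,
            χP σ = ∑ σ' ∈ Finset.univ.filter (fun σ' : L →+* ℂ => σ'.comp (algebraMap K L) = σ),
              χπ σ')
    (hOne : ∀ (K L : Type) [Field K] [NumberField K] [Field L] [NumberField L] [Algebra K L],
      ∀ (n : ℕ), 0 < n → Module.finrank K L = 1 →
      ∀ (hK : isCompact_glFiniteIntegralLevel (1 * n) K)
        (hL : isCompact_glFiniteIntegralLevel n L)
        (P : CuspidalAutomorphicRepData (1 * n) K hK) (π : CuspidalAutomorphicRepData n L hL),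
        IsAutomorphicInductionAlong π.1 P.1 →
        ∀ (TP : InfinityType K (1 * n)) (Tπ : InfinityType L n),
          P.1.HasInfinityType TP → π.1.HasInfinityType Tπ →
          ∀ σ : K →+* ℂ,
            (TP σ).map ArchWeight.a =
              ∑ σ' ∈ Finset.univ.filter (fun σ' : L →+* ℂ => σ'.comp (algebraMap K L) = σ),
                (Tπ σ').map ArchWeight.a)
    (hAIc : automorphicInduction_cyclic_cuspidal)
    (h22 : ∀ (N : ℕ) (K : Type) [Field K] [NumberField K]
      (μ : Measure (gl N K).automorphicQuotient) [(gl N K).IsAutomorphicMeasure μ],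
      JacquetShalika1981_partialPairL_at_one_of_ne_conj (n := N) (K := K) (μ := μ))
    (h23 : ∀ (N : ℕ) (K : Type) [Field K] [NumberField K]
      (μ : Measure (gl N K).automorphicQuotient) [(gl N K).IsAutomorphicMeasure μ],
      JacquetShalika1981_partialPairL_pole_of_eq_conj (n := N) (K := K) (μ := μ))
    (hm1 : ∀ (N : ℕ) (K : Type) [Field K] [NumberField K]
      (μ : Measure (gl N K).automorphicQuotient) [(gl N K).IsAutomorphicMeasure μ],
      multiplicity_one_gl N K μ)
    (hArch : ∀ (N : ℕ) (K : Type) [Field K] [NumberField K]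
      (hK : isCompact_glFiniteIntegralLevel N K) (P : CuspidalAutomorphicRepData N K hK),
      ∃ χ : (K →+* ℂ) → Multiset ℂ, P.1.HasArchParameter χ) :
    Henniart2012_infinityType_of_automorphicInduction := by
  -- the statement on archimedean parameters, `L/K` cyclic of degree `d ≥ 2`, `P` cuspidal of
  -- free rank, `π` cuspidal
  have key : ∀ d : ℕ, 2 ≤ d → ∀ (K L : Type) [Field K] [NumberField K] [Field L]
      [NumberField L] [Algebra K L] [IsGalois K L], IsCyclic (L ≃ₐ[K] L) →
        Module.finrank K L = d → ∀ (n N : ℕ), 0 < n →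
        ∀ (hK : isCompact_glFiniteIntegralLevel N K) (hL : isCompact_glFiniteIntegralLevel n L)
          (P : CuspidalAutomorphicRepData N K hK) (π : CuspidalAutomorphicRepData n L hL),
          IsAutomorphicInductionAlong π.1 P.1 →
          ∀ (χP : (K →+* ℂ) → Multiset ℂ) (χπ : (L →+* ℂ) → Multiset ℂ),
            P.1.HasArchParameter χP → π.1.HasArchParameter χπ →
            ∀ σ : K →+* ℂ,
              χP σ = ∑ σ' ∈ Finset.univ.filter (fun σ' : L →+* ℂ => σ'.comp (algebraMap K L) = σ),
                χπ σ' := by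
    intro d
    induction d using Nat.strong_induction_on with
    | _ d IH =>
    intro hd2 K L _ _ _ _ _ _ hcyc hdL n N hn hK hL P π hAI χP χπ hχP hχπ σ
    haveI : FiniteDimensional K L := Module.Finite.of_restrictScalars_finite ℚ K L
    haveI := hcyc
    by_cases hdprime : d.Prime
    · /- prime degree: `hprime` -/
      exact hprime K L hcyc (hdL ▸ hdprime) n N hn hK hL P π hAI χP χπ hχP hχπ σ
    · /- composite degree: an intermediate field `K₁` with `[L : K₁] = p` prime -/
      obtain ⟨p, hp, hpd⟩ := Nat.exists_prime_and_dvd (show d ≠ 1 by omega)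
      haveI : Fact p.Prime := ⟨hp⟩
      have hcardG : Nat.card (L ≃ₐ[K] L) = d := (IsGalois.card_aut_eq_finrank K L).trans hdL
      obtain ⟨g, hg⟩ := exists_prime_orderOf_dvd_card' (G := L ≃ₐ[K] L) p (hcardG ▸ hpd)
      set H : Subgroup (L ≃ₐ[K] L) := Subgroup.zpowers g with hHdef
      have hH : Nat.card H = p := by rw [hHdef, Nat.card_zpowers, hg]
      -- `H` is normal (the Galois group is cyclic, hence commutative)
      haveI hHn : H.Normal := by
        refine ⟨fun h hh g' => ?_⟩
        obtain ⟨x, hx⟩ := IsCyclic.exists_generator (α := L ≃ₐ[K] L)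
        obtain ⟨a, rfl⟩ := hx g'
        obtain ⟨b, rfl⟩ := hx h
        rwa [← zpow_add, add_comm, zpow_add, mul_assoc, ← zpow_neg, ← zpow_add, add_neg_cancel,
          zpow_zero, mul_one]
      set K₁ : IntermediateField K L := IntermediateField.fixedField H with hK₁def
      haveI : IsGalois K K₁ := IsGalois.of_fixedField_normal_subgroup H
      haveI : NumberField K₁ := NumberField.of_module_finite K K₁
      haveI : IsGalois K₁ L := IsGalois.tower_top_of_isGalois K K₁ L
      have hdegL : Module.finrank K₁ L = p := by
        rw [hK₁def, IntermediateField.finrank_fixedField_eq_card, hH]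
      have hdegK : Module.finrank K K₁ * p = d := by
        rw [← hdegL, Module.finrank_mul_finrank, hdL]
      -- `Gal(L/K₁) ≅ H` and `Gal(K₁/K)` (a quotient of `Gal(L/K)`) are cyclic
      have hcycL : IsCyclic (L ≃ₐ[K₁] L) := by
        haveI : IsCyclic K₁.fixingSubgroup := Subgroup.isCyclic _
        exact isCyclic_of_surjective (IntermediateField.fixingSubgroupEquiv K₁)
          (IntermediateField.fixingSubgroupEquiv K₁).surjective
      have hcycK : IsCyclic (K₁ ≃ₐ[K] K₁) :=
        isCyclic_of_surjective (AlgEquiv.restrictNormalHom (F := K) (K₁ := L) K₁)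
          (AlgEquiv.restrictNormalHom_surjective L)
      -- `2 ≤ [K₁ : K] < d` and `2 ≤ p < d`
      have hd₁lt : Module.finrank K K₁ < d := by
        rw [← hdegK]
        exact lt_mul_of_one_lt_right (Nat.pos_of_ne_zero fun h0 => by
          rw [h0, zero_mul] at hdegK; omega) hp.one_lt
      have hd₁ : 2 ≤ Module.finrank K K₁ := by
        by_contra hlt
        have h0 : Module.finrank K K₁ ≠ 0 := fun h0 => by rw [h0, zero_mul] at hdegK; omega
        have : Module.finrank K K₁ = 1 := by omega
        rw [this, one_mul] at hdegK
        exact hdprime (hdegK ▸ hp)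
      have hplt : p < d := by
        rw [← hdegK]
        exact lt_mul_of_one_lt_left hp.pos (by omega)
      -- the Satake data of `π` are not `Gal(L/K₁)`-stable, `P` being cuspidal (Cor. 6.5)
      have hnst : ¬ IsGaloisStableSatakeAE K₁ π.1 :=
        hAI.not_isGaloisStableSatakeAE_of_cuspidal hn (fun μ _ => h23 N K μ)
          (fun ν _ => h22 n L ν) (fun ν _ => h23 n L ν) (fun ν _ => hm1 n L ν)
          (by rw [hdegL]; exact hp.one_lt)
      -- a cuspidal `P₁ = π^{L/K₁}` over `K₁`, an archimedean parameter of it, `P` from `P₁`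
      obtain ⟨P₁, hAI₁⟩ := hAIc n K₁ L hcycL (hdegL ▸ hp) hn hL
        (isCompact_glFiniteIntegralLevel_holds _ _) π hnst
      have hAI' : IsAutomorphicInductionAlong P₁.1 P.1 := hAI.of_tower hAI₁
      obtain ⟨χ₁, hχ₁⟩ := hArch _ K₁ _ P₁
      -- the identities along `K₁/K` and along `L/K₁` (induction hypothesis), composed
      have hdown := IH (Module.finrank K K₁) hd₁lt hd₁ K K₁ hcycK rfl
        (n * Module.finrank K₁ L) N (Nat.mul_pos hn (hdegL ▸ hp.pos)) hK
        (isCompact_glFiniteIntegralLevel_holds _ _) P P₁ hAI' χP χ₁ hχP hχ₁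
      have hup := IH p hplt hp.two_le K₁ L hcycL hdegL n (n * Module.finrank K₁ L) hn
        (isCompact_glFiniteIntegralLevel_holds _ _) hL P₁ π hAI₁ χ₁ χπ hχ₁ hχπ
      rw [hdown σ, sum_filter_comp_algebraMap_tower K K₁ L χπ σ]
      exact Finset.sum_congr rfl fun σ' _ => hup σ'
  -- the named fact: degree `1` by `hOne`, degree `≥ 2` by `key` on the `a`-multisets
  rw [Henniart2012_infinityType_of_automorphicInduction_iff_along]
  intro K L _ _ _ _ _ _ hcyc n d hn hd hK hL P π hAI TP Tπ hTP hTπ σ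
  haveI : FiniteDimensional K L := Module.Finite.of_restrictScalars_finite ℚ K L
  rcases Nat.lt_or_ge d 2 with h1 | h2
  · obtain rfl : d = 1 := by
      have := Module.finrank_pos (R := K) (M := L); omega
    exact hOne K L n hn hd hK hL P π hAI TP Tπ hTP hTπ σ
  · exact key d h2 K L hcyc hd n (d * n) hn hK hL P π hAI (fun σ => (TP σ).map ArchWeight.a)
      (fun σ' => (Tπ σ').map ArchWeight.a) hTP.2 hTπ.2 σ

/-- **The same with the existence input reduced to Schur's lemma for `W / W'`** (as
`Henniart2012_infinityType_of_automorphicInduction_of_prime_schur`, for cuspidal data): the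
archimedean parameter of a cuspidal `P` is read off an infinitesimal character of `P`
(`AutomorphicRepData.exists_hasArchParameter_of_hasInfinitesimalCharacter`, Harish-Chandra's
isomorphism; Borel–Jacquet 1979, 4.6: the centre `Z(𝔤)` acts on an irreducible admissible
`(𝔤, K_∞) × G(𝔸_f)`-module by a character). So the named fact holds granted: its prime-degree
instance for cuspidal data on Harish-Chandra parameters (`hprime`), its degree-one instance
(`hOne`), Schur's lemma for cuspidal `W / W'` (`hSchur`), and the named facts
`automorphicInduction_cyclic_cuspidal`, `JacquetShalika1981_partialPairL_at_one_of_ne_conj`,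
`JacquetShalika1981_partialPairL_pole_of_eq_conj`, `multiplicity_one_gl`.
[cite: Henniart2012, §3.1, Thm. 5 and Remarque §3.7] [cite: ArthurClozelAMS120, Ch. 3 Thm. 6.2, Lemma 6.4]
[cite: BorelJacquet1979, 4.6] -/
theorem Henniart2012_infinityType_of_automorphicInduction_of_prime_schur_of_cuspidalAI
    (hprime : ∀ (K L : Type) [Field K] [NumberField K] [Field L] [NumberField L] [Algebra K L]
      [IsGalois K L], IsCyclic (L ≃ₐ[K] L) → (Module.finrank K L).Prime →
      ∀ (n N : ℕ), 0 < n →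
      ∀ (hK : isCompact_glFiniteIntegralLevel N K) (hL : isCompact_glFiniteIntegralLevel n L)
        (P : CuspidalAutomorphicRepData N K hK) (π : CuspidalAutomorphicRepData n L hL),
        IsAutomorphicInductionAlong π.1 P.1 →
        ∀ (χP : (K →+* ℂ) → Multiset ℂ) (χπ : (L →+* ℂ) → Multiset ℂ),
          P.1.HasArchParameter χP → π.1.HasArchParameter χπ →
          ∀ σ : K →+* ℂ,
            χP σ = ∑ σ' ∈ Finset.univ.filter (fun σ' : L →+* ℂ => σ'.comp (algebraMap K L) = σ),
              χπ σ')
    (hOne : ∀ (K L : Type) [Field K] [NumberField K] [Field L] [NumberField L] [Algebra K L],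
      ∀ (n : ℕ), 0 < n → Module.finrank K L = 1 →
      ∀ (hK : isCompact_glFiniteIntegralLevel (1 * n) K)
        (hL : isCompact_glFiniteIntegralLevel n L)
        (P : CuspidalAutomorphicRepData (1 * n) K hK) (π : CuspidalAutomorphicRepData n L hL),
        IsAutomorphicInductionAlong π.1 P.1 →
        ∀ (TP : InfinityType K (1 * n)) (Tπ : InfinityType L n),
          P.1.HasInfinityType TP → π.1.HasInfinityType Tπ →
          ∀ σ : K →+* ℂ,
            (TP σ).map ArchWeight.a =
              ∑ σ' ∈ Finset.univ.filter (fun σ' : L →+* ℂ => σ'.comp (algebraMap K L) = σ),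
                (Tπ σ').map ArchWeight.a)
    (hAIc : automorphicInduction_cyclic_cuspidal)
    (h22 : ∀ (N : ℕ) (K : Type) [Field K] [NumberField K]
      (μ : Measure (gl N K).automorphicQuotient) [(gl N K).IsAutomorphicMeasure μ],
      JacquetShalika1981_partialPairL_at_one_of_ne_conj (n := N) (K := K) (μ := μ))
    (h23 : ∀ (N : ℕ) (K : Type) [Field K] [NumberField K]
      (μ : Measure (gl N K).automorphicQuotient) [(gl N K).IsAutomorphicMeasure μ],
      JacquetShalika1981_partialPairL_pole_of_eq_conj (n := N) (K := K) (μ := μ))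
    (hm1 : ∀ (N : ℕ) (K : Type) [Field K] [NumberField K]
      (μ : Measure (gl N K).automorphicQuotient) [(gl N K).IsAutomorphicMeasure μ],
      multiplicity_one_gl N K μ)
    (hSchur : ∀ (N : ℕ) (K : Type) [Field K] [NumberField K]
      (hK : isCompact_glFiniteIntegralLevel N K) (P : CuspidalAutomorphicRepData N K hK),
      ∃ θ : centerU (AutomorphyDatum.gl N K hK).arch →ₐ[ℝ] ℂ, P.1.HasInfinitesimalCharacter θ) :
    Henniart2012_infinityType_of_automorphicInduction :=
  Henniart2012_infinityType_of_automorphicInduction_of_prime_archParameter_of_cuspidalAI hprime hOne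
    hAIc h22 h23 hm1 fun N K _ _ hK P => by
      obtain ⟨θ, hθ⟩ := hSchur N K hK P
      exact P.1.exists_hasArchParameter_of_hasInfinitesimalCharacter hθ

end ReductionArchParameter

end Literature.NumberTheory.Automorphic

end
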